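import Mathlib
import Summits.PneNP.PneNP.Theorems.Nc03AvoidResidualCoreReductionMuxA
import Summits.PneNP.PneNP.Theorems.Nc03AvoidResidualCoreReductionFlip

/-!
# Route Nc03AvoidResidualCore, item `ResidualCoreReduction` — the `MUX` class, II: certificates exist

Helper file for `stmt-PneNP-20227` (sequel of `…ReductionMuxA`, `…ReductionFlip`; cell pnp-ideate,
ROUND-3 Addendum A §A.3 generalised). The data multigraph `G12 I` of a pure `MUX` instance has the
`2N` vertices "variable `v` as a `1`-datum" (`2v`, side A) and "variable `v` as a `0`-datum"
(`2v+1`, side B), one edge per output; balance on it is the hypothesis of `mux_rigid`, which makes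
an attained balanced pattern the LINEAR function `y_j = x_{b_j} + x_{s_j}` on the balanced set. So
(`cert12_range_sound`): a pattern balanced and supported on `P` whose indicator is outside the range
of the linear map `muxMap I P : x ↦ ([j ∈ P] (x_{s_j} + x_{b_j}))_j` (dimension `≤ N`; a rank test)
is not attained. With `P12 I` the greedy packing of all outputs, the one-flip lemma gives such a
pattern among the candidates `flipCol P12 e b` as soon as `5N < M` (`cert12_exists`). [folklore;
ROUND-3 Addendum A]
-/

set_option linter.dupNamespace false -- `Summit.PneNP.PneNP.…`: summit = sub-problem name (D-0017 single-conjunct layout)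

namespace Summit.PneNP.PneNP.Theorems.Nc03Reduction

open Finset Literature.Computability.Complexity

variable {N M : ℕ}

/-- The data multigraph of an instance: edge `j` joins "its role-`1` variable, as an A-vertex `2v`"
to "its role-`2` variable, as a B-vertex `2v+1`". -/
def G12 (I : LocalMap 3 N M) : Bip (Fin M) (Fin (2 * N)) where
  eA j := ⟨2 * (I.vars j 1).val, by have := (I.vars j 1).isLt; omega⟩
  eB j := ⟨2 * (I.vars j 2).val + 1, by have := (I.vars j 2).isLt; omega⟩
  side w := decide (w.val % 2 = 1)
  sideA j := by simp
  sideB j := by simp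

/-- A-endpoints of the data multigraph encode role-`1` variables. -/
theorem G12_eA_eq_iff (I : LocalMap 3 N M) (j : Fin M) (v : Fin N) :
    (G12 I).eA j = ⟨2 * v.val, by have := v.isLt; omega⟩ ↔ I.vars j 1 = v := by
  simp only [G12, Fin.ext_iff]
  omega

/-- B-endpoints of the data multigraph encode role-`2` variables. -/
theorem G12_eB_eq_iff (I : LocalMap 3 N M) (j : Fin M) (v : Fin N) :
    (G12 I).eB j = ⟨2 * v.val + 1, by have := v.isLt; omega⟩ ↔ I.vars j 2 = v := by
  simp only [G12, Fin.ext_iff]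
  omega

/-- Balance on the data multigraph is balance at the two data roles. -/
theorem bal12 (I : LocalMap 3 N M) {P : Finset (Fin M)} {y : Fin M → Bool} (h : (G12 I).Bal P y) :
    (∀ v, (P.filter fun j => I.vars j 1 = v ∧ y j = true).card =
      (P.filter fun j => I.vars j 1 = v ∧ y j = false).card) ∧
    (∀ v, (P.filter fun j => I.vars j 2 = v ∧ y j = true).card =
      (P.filter fun j => I.vars j 2 = v ∧ y j = false).card) := by
  classical
  refine ⟨fun v => ?_, fun v => ?_⟩
  · have h1 := h.1 ⟨2 * v.val, by have := v.isLt; omega⟩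
    have e : ∀ c : Bool, (P.filter fun j => (G12 I).eA j = ⟨2 * v.val, by have := v.isLt; omega⟩ ∧ y j = c) =
        P.filter fun j => I.vars j 1 = v ∧ y j = c := by
      intro c; ext j; simp only [Finset.mem_filter, G12_eA_eq_iff]
    rw [e, e] at h1
    convert h1 using 2
  · have h1 := h.2 ⟨2 * v.val + 1, by have := v.isLt; omega⟩
    have e : ∀ c : Bool, (P.filter fun j => (G12 I).eB j = ⟨2 * v.val + 1, by have := v.isLt; omega⟩ ∧ y j = c) =
        P.filter fun j => I.vars j 2 = v ∧ y j = c := by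
      intro c; ext j; simp only [Finset.mem_filter, G12_eB_eq_iff]
    rw [e, e] at h1
    convert h1 using 2

/-- The linear map of the rigidity certificate: `x ↦ ([j ∈ P] (x_{s_j} + x_{b_j}))_j`. -/
noncomputable def muxMap (I : LocalMap 3 N M) (P : Finset (Fin M)) :
    (Fin N → ZMod 2) →ₗ[ZMod 2] (Fin M → ZMod 2) where
  toFun g := fun j => if j ∈ P then g (I.vars j 0) + g (I.vars j 2) else 0
  map_add' g g' := by
    funext j; simp only [Pi.add_apply]; split_ifs <;> ring
  map_smul' r g := by
    funext j; simp only [Pi.smul_apply, smul_eq_mul, RingHom.id_apply]; split_ifs <;> ring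

/-- **Soundness of the `MUX` certificate, range form**: a pattern balanced and supported on `P`
whose indicator lies outside the range of `muxMap I P` is not attained. -/
theorem cert12_range_sound {I : LocalMap 3 N M} (hP : I.IsPure (rep 12)) {P : Finset (Fin M)}
    {y : Fin M → Bool} (hbal : (G12 I).Bal P y) (hsupp : ∀ j, y j = true → j ∈ P)
    (hout : chiP y ∉ LinearMap.range (muxMap I P)) : y ∉ I.range := by
  classical
  rintro ⟨x, hx⟩
  obtain ⟨hA, hB⟩ := bal12 I hbal
  have hlin := mux_rigid hP P hA hB hx
  apply hout
  refine ⟨fun v => if x v = true then 1 else 0, ?_⟩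
  funext j
  simp only [muxMap, LinearMap.coe_mk, AddHom.coe_mk, chiP_apply]
  by_cases hjP : j ∈ P
  · rw [if_pos hjP, hlin j hjP]
    cases x (I.vars j 0) <;> cases x (I.vars j 2) <;> decide
  · rw [if_neg hjP]
    cases hyj : y j
    · simp
    · exact absurd (hsupp j hyj) hjP

section NeZero

variable [NeZero M]

/-- The packed (even-degree) part of the data multigraph of all outputs. -/
noncomputable def P12 (I : LocalMap 3 N M) : Finset (Fin M) := (G12 I).packUnion Finset.univ

/-- The packed part has even degrees at A-vertices. -/
theorem P12_evenA (I : LocalMap 3 N M) (a : Fin (2 * N)) :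
    Even ((P12 I).filter fun j => (G12 I).eA j = a).card :=
  Bip.Bal.even_degA (G12 I) ((G12 I).bal_packUnion Finset.univ) a

/-- The packed part has even degrees at B-vertices. -/
theorem P12_evenB (I : LocalMap 3 N M) (b : Fin (2 * N)) :
    Even ((P12 I).filter fun j => (G12 I).eB j = b).card :=
  Bip.Bal.even_degB (G12 I) ((G12 I).bal_packUnion Finset.univ) b

/-- The packed part misses at most `2N` outputs. -/
theorem card_P12 (I : LocalMap 3 N M) : M ≤ (P12 I).card + 2 * N := by
  have h := (G12 I).card_le_packUnion Finset.univ
  rw [Finset.card_univ, Fintype.card_fin, Fintype.card_fin] at h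
  exact h

/-- **Soundness of the `MUX` certificate** for the candidate patterns of the packed part. -/
theorem cert12_sound' {I : LocalMap 3 N M} (hP : I.IsPure (rep 12)) {e : Fin M} (heP : e ∈ P12 I)
    (heT : e ∉ (G12 I).forest (P12 I)) (b : Bool)
    (hout : chiP ((G12 I).flipCol (P12 I) e b) ∉ LinearMap.range (muxMap I (P12 I))) :
    (G12 I).flipCol (P12 I) e b ∉ I.range :=
  cert12_range_sound hP ((G12 I).bal_flipCol (P12 I) (P12_evenA I) (P12_evenB I) heP heT b)
    (fun _ hj => (G12 I).mem_of_flipCol heP hj) hout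

/-- **Existence of the `MUX` certificate at linear stretch**: if `5N < M`, some non-forest edge of
the packed part and some bit give a candidate pattern outside the range of the certificate map. -/
theorem cert12_exists (I : LocalMap 3 N M) (hM : 5 * N < M) :
    ∃ e ∈ P12 I, e ∉ (G12 I).forest (P12 I) ∧
      ∃ b : Bool, chiP ((G12 I).flipCol (P12 I) e b) ∉ LinearMap.range (muxMap I (P12 I)) := by
  set U := LinearMap.range (muxMap I (P12 I)) with hU
  have hdim : Module.finrank (ZMod 2) U ≤ N := by
    have h := LinearMap.finrank_range_le (muxMap I (P12 I))
    rw [Module.finrank_fintype_fun_eq_card, Fintype.card_fin] at h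
    exact h
  have hcard := card_P12 I
  have hhyp : Module.finrank (ZMod 2) U + Fintype.card (Fin (2 * N)) < (P12 I).card := by
    rw [Fintype.card_fin]; omega
  obtain ⟨e, heP, heT, b, hb⟩ := (G12 I).exists_flipCol_not_mem (P12 I) U hhyp 0
  refine ⟨e, heP, heT, b, ?_⟩
  rwa [zero_add] at hb

/-- **`MUX` at linear stretch**: a pure `MUX` instance with `5N < M` misses a pattern. -/
theorem exists_not_mem_range_mux {I : LocalMap 3 N M} (hP : I.IsPure (rep 12)) (hM : 5 * N < M) :
    ∃ y, y ∉ I.range := by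
  obtain ⟨e, heP, heT, b, hb⟩ := cert12_exists I hM
  exact ⟨_, cert12_sound' hP heP heT b hb⟩

end NeZero

end Summit.PneNP.PneNP.Theorems.Nc03Reduction
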